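import Literature.Analysis.FluidPDE.NSGaldiExtendedTest
import HarnessLib

/-!
# Extension of the homogeneous weak Stokes identity to curl-type test fields without compact
# spatial support

Analysis/FluidPDE support file (everything proved; no named facts) on the discharge path of
`Literature.Analysis.FluidPDE.KNSS2009_weak_driftMild` (`KNSSRegularityDecomposition.lean`;
Koch–Nadirashvili–Seregin–Šverák 2009, Lemma 3.1). After the subtraction of the mild solution
(`OseenDuhamelWeakStokes.lean`), Lemma 3.1 is a statement about a **bounded weak solution `z` of
the homogeneous Stokes system** on `ℝⁿ × (0, T)`: `div z = 0` and `∫∫ ⟪z, ∂ₜψ + Δψ⟫ = 0` for all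
smooth compactly supported divergence-free `ψ` (KNSS §3 p. 7). The tree's proof of the lemma is
by duality with caloric test data `e^{(t₁−τ)Δ}g`, which decay but are **not compactly supported
in space**; as in the Galdi programme (`NSGaldiExtendedTest.lean`) no pressure / divergence
correction is needed if the test fields are of **curl type**, `ψ = (∂ₐΨ) c − (∂_cΨ) a` for a
scalar `Ψ`, since these are divergence free for *every* smooth `Ψ` and the spatial cut-off can be
placed inside the curl. This file proves the corresponding density step for the `L^∞` class:

* `weakStokes_curlPair_extended` — for `z` jointly a.e. strongly measurable on the slab with
  `‖z‖ ≤ Z`, satisfying the homogeneous weak Stokes identity for all divergence-free space–time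
  test fields on `(0, T) × E`, and `Ψ` jointly smooth with time support in `[t₀, b]`,
  `0 < t₀ ≤ b < T`, `D^{≤3}Ψ ∈ L¹` and `D^{≤1}∂ₜΨ ∈ L¹` of the slab:
  `∫₀ᵀ ∫ ⟪z, ∂ₜψ + Δψ⟫ = 0` for `ψ = (∂ₐΨ) c − (∂_cΨ) a`.

The proof is that of `IsWeakNSSolutionOn.weakForm_curlPair_extended` (Galdi 2019, Lemma A.1 for
`L⁴(Q_T)` solutions) with the `L⁴ × L^{4/3}` Hölder pairing replaced by `L^∞ × L¹` and without
convection and datum terms: the identity holds for `ψ_R = (∂ₐ(χ_RΨ)) c − (∂_c(χ_RΨ)) a`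
(`isSpaceTimeTestOn_cutoff_mul_Ioo`, the open-slab twin of `isSpaceTimeTestOn_cutoff_mul`), the
integrands are eventually equal pointwise (`eventually_forall_cutoff_mul_eq`), and the Leibniz rule
with the uniform cut-off bounds (`norm_iteratedFDeriv_mul_le_of_le`,
`exists_norm_iteratedFDeriv_cutoff_le`) gives the integrable majorant
`Z · 2‖a‖‖c‖ (K₁ |D^{≤1}∂ₜΨ| + dim E · K₃ |D^{≤3}Ψ|)`; dominated convergence concludes. No new
definitions (the map `ℓ ↦ ℓ a • c − ℓ c • a` is written out).

## Mathlib / tree search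

Tree: `NSGaldiExtendedTest` (`contDiff_uncurry_cutoff_mul`, `contDiff_uncurry_curlPair`,
`isSpaceTimeTestOn_curlPair`, `isDivFree_curlPair`, `timeDeriv_curlPair`, `norm_curlPair_le`,
`norm_laplacian_curlPair_le`, `timeDeriv_cutoff_mul`, `eventually_forall_cutoff_mul_eq`,
`contDiff_uncurry_timeDeriv`, `isSmoothSpaceTimeOn_univ_of_contDiff`), `cutoff` (`WholeSpaceIBP`).
`lean search 'curlPair_extended|weakStokes'`: only the `L⁴` theorem. Mathlib:
`tendsto_integral_of_dominated_convergence`, `integral_prod`, `laplacian_congr_nhds`.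

## References

* G. Koch, N. Nadirashvili, G. Seregin, V. Šverák, *Liouville theorems for the Navier–Stokes
  equations and applications*, Acta Math. 203 (2009) = arXiv:0709.3599v1, §3 p. 7 (weak
  solutions of the linear Stokes system; Lemma 3.1). [KochNadirashviliSereginSverak2009]
* G. P. Galdi, *On the energy equality for distributional solutions to Navier–Stokes equations*,
  Proc. AMS 147 (2019), Lemma A.1. [Galdi2018]
-/

open MeasureTheory TopologicalSpace Set Function Filter Topology InnerProductSpace Metric
open scoped RealInnerProductSpace ENNReal NNReal ContDiff Laplacian

noncomputable section

namespace Literature.Analysis.FluidPDE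

variable {E : Type*} [NormedAddCommGroup E] [InnerProductSpace ℝ E] [FiniteDimensional ℝ E]

/-! ### Cut-off products on the open slab `(0, T) × E` -/

section Cutoff

variable {Φ : ℝ → E → ℝ}

/-- **Cut-off products of time-compactly supported smooth functions are space–time test functions
on the open slab `(0, T) × E`**: if `Φ` is jointly smooth and `Φ(t) = 0` for `t ∉ [t₀, b]` with
`0 < t₀` and `b < T`, then `χ_R Φ` is a space–time test function on `(0, T) × E` for every
`R > 0` (twin of `isSpaceTimeTestOn_cutoff_mul`, which treats the slab `t < T`). [folklore] -/
theorem isSpaceTimeTestOn_cutoff_mul_Ioo (hΦ : ContDiff ℝ ∞ (uncurry Φ)) {t₀ b T : ℝ}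
    (ht₀ : 0 < t₀) (hbT : b < T) (hsupp : ∀ t, t ∉ Icc t₀ b → Φ t = 0) {R : ℝ} (hR : 0 < R) :
    IsSpaceTimeTestOn (slab E (Ioo 0 T) isOpen_Ioo) (fun t x => cutoff R x * Φ t x) := by
  have hsub : tsupport (uncurry fun t x => cutoff R x * Φ t x) ⊆
      Icc t₀ b ×ˢ closedBall (0 : E) (2 * R) := by
    refine closure_minimal (fun p hp => ?_) (isClosed_Icc.prod isClosed_closedBall)
    obtain ⟨t, x⟩ := p
    rw [mem_support] at hp
    refine ⟨?_, ?_⟩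
    · by_contra ht
      exact hp (by simp [uncurry, hsupp t ht])
    · by_contra hx
      rw [mem_closedBall, dist_zero_right, not_le] at hx
      exact hp (by simp [uncurry, cutoff_eq_zero hR hx.le])
  refine ⟨contDiff_uncurry_cutoff_mul hΦ R, ?_, ?_⟩
  · exact IsCompact.of_isClosed_subset (isCompact_Icc.prod (isCompact_closedBall _ _))
      (isClosed_tsupport _) hsub
  · intro p hp
    rw [SetLike.mem_coe, mem_slab]
    exact ⟨lt_of_lt_of_le ht₀ (hsub hp).1.1, lt_of_le_of_lt (hsub hp).1.2 hbT⟩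

end Cutoff

/-! ### The extension theorem -/

section Extension

variable [MeasurableSpace E] [BorelSpace E]

/-- Measurability of the Stokes integrand `⟪V, ∂ₜΘ + ΔΘ⟫` built from a jointly smooth test field
and a jointly measurable field. [folklore] -/
theorem aestronglyMeasurable_stokesIntegrand {μ : Measure (ℝ × E)} {V : ℝ × E → E}
    (hV : AEStronglyMeasurable V μ) {Θ : ℝ → E → E} (hΘ : ContDiff ℝ ∞ (uncurry Θ)) :
    AEStronglyMeasurable (fun p : ℝ × E => ⟪V p, timeDeriv Θ p.1 p.2 + Δ (Θ p.1) p.2⟫) μ := by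
  have h1 : Continuous fun p : ℝ × E => timeDeriv Θ p.1 p.2 :=
    (contDiff_uncurry_timeDeriv hΘ).continuous
  have h3 : Continuous fun p : ℝ × E => Δ (Θ p.1) p.2 := by
    have h := (isSmoothSpaceTimeOn_univ_of_contDiff hΘ).laplacian uniqueDiffOn_univ
    exact (contDiff_of_isSmoothSpaceTimeOn_univ h).continuous
  exact hV.inner (h1.add h3).aestronglyMeasurable

/-- **Extension of the homogeneous weak Stokes identity to curl-type test fields without compact
spatial support.** Let `z` be jointly a.e. strongly measurable on the slab `(0, T) × E` with
`‖z(t, x)‖ ≤ Z` for `t ∈ (0, T)`, and suppose the homogeneous weak Stokes identity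
`∫₀ᵀ ∫ ⟪z, ∂ₜψ + Δψ⟫ = 0` holds for every space–time test field `ψ` on the slab with
divergence-free slices (the bounded weak solutions of the linear Stokes system with `f = 0` of
Koch–Nadirashvili–Seregin–Šverák 2009, §3 p. 7). Let `Ψ : ℝ → E → ℝ` be jointly smooth with
`Ψ(t) = 0` for `t ∉ [t₀, b]`, `0 < t₀`, `b < T`, with spatial derivatives of orders `≤ 3` in
`L¹` of the slab and `D^{≤1}∂ₜΨ` in `L¹` of the slab. Then the identity holds for the
(divergence-free, in general not compactly supported in space) curl-type field
`ψ = (∂ₐΨ) c − (∂_cΨ) a`: `∫₀ᵀ ∫ ⟪z, ∂ₜψ + Δψ⟫ = 0`.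
Proof: the identity holds for the honest test fields `ψ_R = (∂ₐ(χ_RΨ)) c − (∂_c(χ_RΨ)) a` and
passes to the limit `R → ∞` by dominated convergence — pointwise `ψ_R` and its derivatives
eventually coincide with those of `ψ`, and the Leibniz rule with `‖Dᵏχ_R‖ ≤ C` (`R ≥ 1`) bounds
`|⟪z, ∂ₜψ_R⟫| + |⟪z, Δψ_R⟫|` by the integrable majorant `Z · A (K₁ |D^{≤1}∂ₜΨ| + dim E · K₃ |D^{≤3}Ψ|)`
(`L^∞ × L¹` on the slab). This is the `L^∞` twin of `IsWeakNSSolutionOn.weakForm_curlPair_extended`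
(Galdi 2019, Lemma A.1 for `L⁴(Q_T)` solutions). [folklore] -/
theorem weakStokes_curlPair_extended {T Z : ℝ} {z : ℝ → E → E}
    (hzm : AEStronglyMeasurable (uncurry z) ((volume.restrict (Ioo 0 T)).prod (volume : Measure E)))
    (hZ : ∀ t ∈ Ioo 0 T, ∀ x, ‖z t x‖ ≤ Z)
    (hweak : ∀ ψ : ℝ → E → E, IsSpaceTimeTestOn (slab E (Ioo 0 T) isOpen_Ioo) ψ →
      (∀ t, VectorCalculus.IsDivFree (ψ t)) →
      ∫ t in Ioo 0 T, ∫ x, ⟪z t x, timeDeriv ψ t x + Δ (ψ t) x⟫ = 0)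
    {Ψ : ℝ → E → ℝ} (hΨ : ContDiff ℝ ∞ (uncurry Ψ)) {t₀ b : ℝ} (ht₀ : 0 < t₀) (hbT : b < T)
    (hsupp : ∀ t, t ∉ Icc t₀ b → Ψ t = 0)
    (hL1 : ∀ k ≤ 3, Integrable (fun p : ℝ × E => iteratedFDeriv ℝ k (Ψ p.1) p.2)
      ((volume.restrict (Ioo 0 T)).prod (volume : Measure E)))
    (htL1 : ∀ k ≤ 1, Integrable (fun p : ℝ × E => iteratedFDeriv ℝ k (timeDeriv Ψ p.1) p.2)
      ((volume.restrict (Ioo 0 T)).prod (volume : Measure E)))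
    (a c : E) {ψ : ℝ → E → E}
    (hψ : ∀ t x, ψ t x = (fderiv ℝ (Ψ t) x a) • c - (fderiv ℝ (Ψ t) x c) • a) :
    ∫ t in Ioo 0 T, ∫ x, ⟪z t x, timeDeriv ψ t x + Δ (ψ t) x⟫ = 0 := by
  -- ### notation and the cut-off approximants
  set L : (E →L[ℝ] ℝ) →L[ℝ] E :=
    ((ContinuousLinearMap.apply ℝ ℝ a).smulRight c - (ContinuousLinearMap.apply ℝ ℝ c).smulRight a)
    with hL_def
  have hLapp : ∀ ℓ : E →L[ℝ] ℝ, L ℓ = ℓ a • c - ℓ c • a := fun ℓ => by simp [hL_def]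
  obtain rfl : ψ = fun t x => L (fderiv ℝ (Ψ t) x) := by
    funext t x; rw [hψ, hLapp]
  set μ : Measure (ℝ × E) := (volume.restrict (Ioo 0 T)).prod (volume : Measure E) with hμ
  set Φ : ℕ → ℝ → E → ℝ := fun n t x => cutoff ((n : ℝ) + 1) x * Ψ t x with hΦ_def
  set ψn : ℕ → ℝ → E → E := fun n t x => L (fderiv ℝ (Φ n t) x) with hψn_def
  have hn1 : ∀ n : ℕ, (1 : ℝ) ≤ (n : ℝ) + 1 := fun n => by
    have : (0 : ℝ) ≤ n := n.cast_nonneg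
    linarith
  have hΦs : ∀ n, ContDiff ℝ ∞ (uncurry (Φ n)) := fun n => contDiff_uncurry_cutoff_mul hΨ _
  have hψns : ∀ n, ContDiff ℝ ∞ (uncurry (ψn n)) := fun n => contDiff_uncurry_curlPair (hΦs n)
  have hψs : ContDiff ℝ ∞ (uncurry fun t x => L (fderiv ℝ (Ψ t) x)) := contDiff_uncurry_curlPair hΨ
  have htest : ∀ n, IsSpaceTimeTestOn (slab E (Ioo 0 T) isOpen_Ioo) (ψn n) := fun n =>
    isSpaceTimeTestOn_curlPair (isSpaceTimeTestOn_cutoff_mul_Ioo hΨ ht₀ hbT hsupp (by positivity))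
  have hdiv : ∀ n t, VectorCalculus.IsDivFree (ψn n t) := fun n t => isDivFree_curlPair (hΦs n) t
  -- ### the weak formulation for the approximants
  have hweakn : ∀ n, ∫ t in Ioo 0 T, ∫ x, ⟪z t x, timeDeriv (ψn n) t x + Δ (ψn n t) x⟫ = 0 :=
    fun n => hweak (ψn n) (htest n) (hdiv n)
  -- ### cut-off constants
  obtain ⟨C₀, hC₀0, hC₀⟩ := exists_norm_iteratedFDeriv_cutoff_le (E := E) 0
  obtain ⟨C₁, hC₁0, hC₁⟩ := exists_norm_iteratedFDeriv_cutoff_le (E := E) 1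
  obtain ⟨C₂, hC₂0, hC₂⟩ := exists_norm_iteratedFDeriv_cutoff_le (E := E) 2
  obtain ⟨C₃, hC₃0, hC₃⟩ := exists_norm_iteratedFDeriv_cutoff_le (E := E) 3
  set C : ℝ := max (max C₀ C₁) (max C₂ C₃) with hC_def
  have hCall : ∀ i ≤ 3, ∀ n : ℕ, ∀ x : E, ‖iteratedFDeriv ℝ i (cutoff ((n : ℝ) + 1)) x‖ ≤ C := by
    intro i hi n x
    interval_cases i
    · exact (hC₀ _ (hn1 n) x).trans ((le_max_left _ _).trans (le_max_left _ _))
    · exact (hC₁ _ (hn1 n) x).trans ((le_max_right _ _).trans (le_max_left _ _))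
    · exact (hC₂ _ (hn1 n) x).trans ((le_max_left _ _).trans (le_max_right _ _))
    · exact (hC₃ _ (hn1 n) x).trans ((le_max_right _ _).trans (le_max_right _ _))
  -- Leibniz constants and sums of derivative norms
  set K : ℕ → ℝ := fun m => ∑ i ∈ Finset.range (m + 1), (m.choose i : ℝ) * C with hK_def
  set S : ℕ → ℝ × E → ℝ := fun m p => ∑ k ∈ Finset.range (m + 1), ‖iteratedFDeriv ℝ k (Ψ p.1) p.2‖
    with hS_def
  set S' : ℝ × E → ℝ := fun p => ∑ k ∈ Finset.range 2, ‖iteratedFDeriv ℝ k (timeDeriv Ψ p.1) p.2‖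
    with hS'_def
  have hLeib : ∀ n (m : ℕ), m ≤ 3 → ∀ t x,
      ‖iteratedFDeriv ℝ m (Φ n t) x‖ ≤ K m * S m (t, x) := by
    intro n m hm t x
    exact norm_iteratedFDeriv_mul_le_of_le (contDiff_cutoff _) (contDiff_slice_of_contDiff_uncurry hΨ t)
      (fun i hi => hCall i (hi.trans hm) n x)
  have hLeib' : ∀ n t x, ‖iteratedFDeriv ℝ 1 (timeDeriv (Φ n) t) x‖ ≤ K 1 * S' (t, x) := by
    intro n t x
    rw [show timeDeriv (Φ n) t = fun x => cutoff ((n : ℝ) + 1) x * timeDeriv Ψ t x from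
      timeDeriv_cutoff_mul _ _]
    exact norm_iteratedFDeriv_mul_le_of_le (contDiff_cutoff _)
      (contDiff_slice_of_contDiff_uncurry (contDiff_uncurry_timeDeriv hΨ) t)
      (fun i hi => hCall i (hi.trans (by norm_num)) n x)
  -- ### integrability of the sums of derivative norms
  have hS3 : Integrable (S 3) μ :=
    integrable_finsetSum _ fun k hk => (hL1 k (Nat.lt_succ_iff.1 (Finset.mem_range.1 hk))).norm
  have hS'm : Integrable S' μ :=
    integrable_finsetSum _ fun k hk => (htL1 k (Nat.lt_succ_iff.1 (Finset.mem_range.1 hk))).norm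
  -- ### the field on the slab
  set V : ℝ × E → E := uncurry z with hV_def
  have hVm : AEStronglyMeasurable V μ := hzm
  set Z' : ℝ := max Z 0 with hZ'_def
  have hZ'0 : 0 ≤ Z' := le_max_right _ _
  have hVb : ∀ᵐ p ∂μ, ‖V p‖ ≤ Z' := by
    have h : ∀ᵐ p ∂μ, p.1 ∈ Ioo 0 T :=
      (Measure.quasiMeasurePreserving_fst (μ := volume.restrict (Ioo 0 T))
        (ν := (volume : Measure E))).ae (ae_restrict_mem measurableSet_Ioo)
    filter_upwards [h] with p hp
    exact (hZ p.1 hp p.2).trans (le_max_left _ _)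
  -- ### the integrands and the majorant
  set Fn : ℕ → ℝ × E → ℝ := fun n p => ⟪V p, timeDeriv (ψn n) p.1 p.2 + Δ (ψn n p.1) p.2⟫ with hFn_def
  set F : ℝ × E → ℝ := fun p => ⟪V p, timeDeriv (fun t x => L (fderiv ℝ (Ψ t) x)) p.1 p.2 +
    Δ (fun x => L (fderiv ℝ (Ψ p.1) x)) p.2⟫ with hF_def
  set A : ℝ := 2 * ‖a‖ * ‖c‖ with hA_def
  set G : ℝ × E → ℝ := fun p => Z' * (A * K 1 * S' p + A * (Module.finrank ℝ E) * K 3 * S 3 p)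
    with hG_def
  have hGint : Integrable G μ :=
    (((hS'm.const_mul (A * K 1)).add (hS3.const_mul (A * (Module.finrank ℝ E) * K 3))).const_mul Z')
  have hFn_meas : ∀ n, AEStronglyMeasurable (Fn n) μ := fun n =>
    aestronglyMeasurable_stokesIntegrand hVm (hψns n)
  have hF_meas : AEStronglyMeasurable F μ := aestronglyMeasurable_stokesIntegrand hVm hψs
  -- ### the pointwise bound (where `‖V‖ ≤ Z'`)
  have hbound' : ∀ n p, ‖V p‖ ≤ Z' → ‖Fn n p‖ ≤ G p := by
    intro n p hVp
    obtain ⟨t, x⟩ := p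
    have hΦnt : ContDiff ℝ ∞ (Φ n t) := contDiff_slice_of_contDiff_uncurry (hΦs n) t
    have e1 : ‖timeDeriv (ψn n) t x‖ ≤ A * K 1 * S' (t, x) := by
      rw [show timeDeriv (ψn n) t x = L (fderiv ℝ (timeDeriv (Φ n) t) x) from
        timeDeriv_curlPair (hΦs n) t x]
      calc ‖L (fderiv ℝ (timeDeriv (Φ n) t) x)‖
          ≤ 2 * ‖a‖ * ‖c‖ * ‖iteratedFDeriv ℝ 1 (timeDeriv (Φ n) t) x‖ := norm_curlPair_le x
        _ ≤ 2 * ‖a‖ * ‖c‖ * (K 1 * S' (t, x)) := by gcongr; exact hLeib' n t x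
        _ = A * K 1 * S' (t, x) := by rw [hA_def]; ring
    have e3 : ‖Δ (ψn n t) x‖ ≤ A * (Module.finrank ℝ E) * K 3 * S 3 (t, x) := by
      calc ‖Δ (ψn n t) x‖ ≤ 2 * ‖a‖ * ‖c‖ * (Module.finrank ℝ E) * ‖iteratedFDeriv ℝ 3 (Φ n t) x‖ :=
            norm_laplacian_curlPair_le hΦnt x
        _ ≤ 2 * ‖a‖ * ‖c‖ * (Module.finrank ℝ E) * (K 3 * S 3 (t, x)) := by
            gcongr; exact hLeib n 3 le_rfl t x
        _ = A * (Module.finrank ℝ E) * K 3 * S 3 (t, x) := by rw [hA_def]; ring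
    calc ‖Fn n (t, x)‖ ≤ ‖V (t, x)‖ * ‖timeDeriv (ψn n) t x + Δ (ψn n t) x‖ := norm_inner_le_norm _ _
      _ ≤ Z' * (A * K 1 * S' (t, x) + A * (Module.finrank ℝ E) * K 3 * S 3 (t, x)) := by
          refine mul_le_mul hVp ((norm_add_le _ _).trans (add_le_add e1 e3)) (norm_nonneg _) hZ'0
      _ = G (t, x) := by simp only [hG_def]
  have hbound : ∀ n, ∀ᵐ p ∂μ, ‖Fn n p‖ ≤ G p := fun n => by
    filter_upwards [hVb] with p hp using hbound' n p hp
  -- ### pointwise convergence: the integrands are eventually equal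
  have hlim : ∀ p, Tendsto (fun n => Fn n p) atTop (𝓝 (F p)) := by
    intro p
    obtain ⟨t, x⟩ := p
    refine tendsto_const_nhds.congr' ?_
    filter_upwards [eventually_forall_cutoff_mul_eq Ψ x] with n hn
    have hloc : ∀ s, ∀ y ∈ ball x 1, ψn n s y = L (fderiv ℝ (Ψ s) y) := by
      intro s y hy
      have hev : Φ n s =ᶠ[𝓝 y] Ψ s := by
        filter_upwards [isOpen_ball.mem_nhds hy] with w hw
        exact hn s w hw
      show L (fderiv ℝ (Φ n s) y) = L (fderiv ℝ (Ψ s) y)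
      rw [hev.fderiv_eq]
    have hloc' : ∀ s, ψn n s =ᶠ[𝓝 x] fun y => L (fderiv ℝ (Ψ s) y) := fun s => by
      filter_upwards [isOpen_ball.mem_nhds (mem_ball_self one_pos)] with y hy
      exact hloc s y hy
    have q1 : timeDeriv (ψn n) t x = timeDeriv (fun t x => L (fderiv ℝ (Ψ t) x)) t x := by
      simp only [timeDeriv_apply]
      congr 1
      funext s
      exact hloc s x (mem_ball_self one_pos)
    have q3 : Δ (ψn n t) x = Δ (fun y => L (fderiv ℝ (Ψ t) y)) x :=
      (laplacian_congr_nhds (hloc' t)).eq_of_nhds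
    simp only [hFn_def, hF_def, q1, q3]
  -- ### dominated convergence on the slab
  have hFint : ∀ n, Integrable (Fn n) μ := fun n => hGint.mono' (hFn_meas n) (hbound n)
  have hFint' : Integrable F μ := by
    refine hGint.mono' hF_meas ?_
    filter_upwards [hVb] with p hp
    exact le_of_tendsto' ((hlim p).norm) fun n => hbound' n p hp
  have hDCT : Tendsto (fun n => ∫ p, Fn n p ∂μ) atTop (𝓝 (∫ p, F p ∂μ)) :=
    tendsto_integral_of_dominated_convergence G hFn_meas hGint hbound (Eventually.of_forall hlim)
  -- ### conclusion
  have hprod : ∀ n, (∫ t in Ioo 0 T, ∫ x, ⟪z t x, timeDeriv (ψn n) t x + Δ (ψn n t) x⟫) =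
      ∫ p, Fn n p ∂μ := by
    intro n
    rw [hμ, integral_prod _ (hFint n)]
    rfl
  have hprod' : (∫ t in Ioo 0 T, ∫ x, ⟪z t x, timeDeriv (fun t x => L (fderiv ℝ (Ψ t) x)) t x +
      Δ (fun x => L (fderiv ℝ (Ψ t) x)) x⟫) = ∫ p, F p ∂μ := by
    rw [hμ, integral_prod _ hFint']
    rfl
  have hzero : (fun n => ∫ p, Fn n p ∂μ) = fun _ => 0 := by
    funext n
    rw [← hprod n]
    exact hweakn n
  rw [hzero] at hDCT
  rw [hprod']
  exact tendsto_nhds_unique hDCT tendsto_const_nhds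

end Extension

end Literature.Analysis.FluidPDE
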